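import Summits.CriticalPhenomena.Ising3DConformalLimit.Theorems.MoebiusRestrictionCurrentsTargetSuffices

/-!
# `Assembly` — the route `MoebiusRestrictionCurrents` assembles

Route `route-CriticalPhenomena-MoebiusRestrictionCurrents`, item `stmt-CriticalPhenomena-4861`
(assembly, rank 1):
`TwoPointDomainTheory → RemovalRatioInversion → BackboneLift → IsingEuclidUpgradeR4NonGaussian →
FreeIsCritical → Ising3DConformalLimit`.

The assembly is the composition of the two glue steps of the route:

* `moebiusRestrictionCurrents_cruxesGiveTarget_proof` (the support item `CruxesGiveTarget`,
  stmt-4859): `TwoPointDomainTheory → RemovalRatioInversion → BackboneLift → Target`. From the two-point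
  domain theory take `Δ > 0` and the two-point domain kernel `H`. The only non-bookkeeping step is
  the INVERSION COVARIANCE of `H_D` for admissible `D ∌ 0`, which `BackboneLift` wants as input:
  - the unit inversion `ι` preserves admissibility of domains avoiding the origin
    (`adm_image_inversion`: `ι '' D` is open, and its frontier lies in `ι '' (∂D ∖ {0}) ∪ {0}`,
    a Lebesgue-null set because `ι` is `C¹` off the origin —
    `MeasureTheory.addHaar_image_eq_zero_of_differentiableOn_of_addHaar_eq_zero`);
  - pointwise limits of the rescaled two-point functions of `D`, `ℝ³`, `ι '' D` at `(x,y)`,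
    `(ιx, ιy)` and `RemovalRatioInversion` give, by uniqueness of limits,
    `H_{ιD}(ιx,ιy) / H_{ℝ³}(ιx,ιy) = H_D(x,y) / H_{ℝ³}(x,y)` (`div_eq_div_of_tendsto`);
  - Euclidean and scale covariance make the full-space kernel radial,
    `H_{ℝ³}(x,y) = ‖y − x‖^{−2Δ} H_{ℝ³}(0,e₁)` (`twoPoint_radial`: translate, reflect `e₁` to
    `(y−x)/‖y−x‖`, dilate), and `‖ιx − ιy‖ = ‖x − y‖/(‖x‖‖y‖)` then gives
    `H_{ℝ³}(ιx,ιy) = ‖x‖^{2Δ}‖y‖^{2Δ}H_{ℝ³}(x,y)` (`twoPoint_inversion`);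
  - hence `H_{ιD}(ιx,ιy) = ‖x‖^{2Δ}‖y‖^{2Δ}H_D(x,y)`.
  `BackboneLift` then produces the domain family `S`; positivity of `S^{ℝ³}_2` is `S_2 = H` and
  `H_{ℝ³} > 0`.
* `moebiusRestrictionCurrents_targetSuffices_proof` (tree, item stmt-4860):
  `Target → IsingEuclidUpgradeR4NonGaussian → FreeIsCritical → Ising3DConformalLimit`.

No named facts are used. References: Di Francesco–Mathieu–Sénéchal 1997, §4.3.1 (two-point
function of a scale/rotation covariant theory, eq. (4.55), and its inversion covariance);
Duminil-Copin, ICM 2022, §8.1–8.2 (covariance reading of conformal invariance, domain version).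
-/

noncomputable section

namespace Summit.CriticalPhenomena.Ising3DConformalLimit.Theorems

open Summit.CriticalPhenomena.Ising3DConformalLimit.Theses.MoebiusRestrictionCurrents
open Literature.Probability.LatticeModels
open Filter Topology Set Function EuclideanGeometry MeasureTheory

namespace MoebiusRestrictionCurrentsAssembly

open MoebiusRestrictionCurrentsTargetSuffices

/-! ### The unit inversion preserves admissibility of domains avoiding the origin -/

/-- The unit inversion of `ℝ³` is continuous off the origin. [folklore] -/
theorem continuousOn_inversion_compl_zero :
    ContinuousOn (inversion (0 : EuclideanSpace ℝ (Fin 3)) 1)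
      ({0}ᶜ : Set (EuclideanSpace ℝ (Fin 3))) :=
  ContinuousOn.inversion (c := fun _ => (0 : EuclideanSpace ℝ (Fin 3))) (R := fun _ => (1 : ℝ))
    (x := fun a => a) continuousOn_const continuousOn_const continuousOn_id (fun _ ha => ha)

/-- The unit inversion of `ℝ³` is differentiable off the origin. [folklore] -/
theorem differentiableOn_inversion_compl_zero :
    DifferentiableOn ℝ (inversion (0 : EuclideanSpace ℝ (Fin 3)) 1)
      ({0}ᶜ : Set (EuclideanSpace ℝ (Fin 3))) :=
  DifferentiableOn.inversion (c := fun _ => (0 : EuclideanSpace ℝ (Fin 3))) (R := fun _ => (1 : ℝ))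
    (x := fun a => a) (differentiableOn_const _) (differentiableOn_const _) differentiableOn_id
    (fun _ ha => ha)

/-- The unit inversion is an involution, so images are preimages. [folklore] -/
theorem image_inversion_eq_preimage (D : Set (EuclideanSpace ℝ (Fin 3))) :
    inversion (0 : EuclideanSpace ℝ (Fin 3)) 1 '' D =
      inversion (0 : EuclideanSpace ℝ (Fin 3)) 1 ⁻¹' D :=
  congrFun (inversion_involutive (0 : EuclideanSpace ℝ (Fin 3)) one_ne_zero).image_eq_preimage_symm
    D

/-- The unit inversion maps open sets avoiding the origin to open sets. [folklore] -/
theorem isOpen_image_inversion {D : Set (EuclideanSpace ℝ (Fin 3))} (hD : IsOpen D)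
    (h0 : (0 : EuclideanSpace ℝ (Fin 3)) ∉ D) :
    IsOpen (inversion (0 : EuclideanSpace ℝ (Fin 3)) 1 '' D) := by
  rw [image_inversion_eq_preimage D]
  refine continuousOn_inversion_compl_zero.isOpen_preimage isOpen_compl_singleton ?_ hD
  intro a ha h
  rw [mem_singleton_iff] at h
  rw [mem_preimage, h, inversion_self] at ha
  exact h0 ha

/-- The frontier of the inverted domain lies in the inversion of the frontier (off the origin)
together with the origin. [folklore] -/
theorem frontier_image_inversion_subset {D : Set (EuclideanSpace ℝ (Fin 3))} (hD : IsOpen D)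
    (h0 : (0 : EuclideanSpace ℝ (Fin 3)) ∉ D) :
    frontier (inversion (0 : EuclideanSpace ℝ (Fin 3)) 1 '' D) ⊆
      inversion (0 : EuclideanSpace ℝ (Fin 3)) 1 '' (frontier D \ {0}) ∪ {0} := by
  intro p hp
  by_cases hp0 : p = 0
  · exact Or.inr hp0
  left
  rw [(isOpen_image_inversion hD h0).frontier_eq] at hp
  obtain ⟨hpc, hpn⟩ := hp
  have hinv := inversion_involutive (0 : EuclideanSpace ℝ (Fin 3)) one_ne_zero
  refine ⟨inversion 0 1 p, ⟨?_, ?_⟩, hinv p⟩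
  · rw [hD.frontier_eq]
    constructor
    · have hc : ContinuousAt (inversion (0 : EuclideanSpace ℝ (Fin 3)) 1) p :=
        ContinuousAt.inversion (c := fun _ => (0 : EuclideanSpace ℝ (Fin 3))) (R := fun _ => (1 : ℝ))
          (x := fun a => a) continuousAt_const continuousAt_const continuousAt_id hp0
      have h := mem_closure_image hc hpc
      rwa [hinv.leftInverse.image_image] at h
    · intro hmem
      exact hpn ⟨inversion 0 1 p, hmem, hinv p⟩
  · rw [mem_singleton_iff, inversion_eq_center one_ne_zero]
    exact hp0

/-- **Admissibility is inversion invariant off the origin.** If `D ⊆ ℝ³` is open with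
Lebesgue-null frontier and `0 ∉ D`, then so is `ι '' D` for the unit inversion `ι`: the frontier
of `ι '' D` is contained in `ι '' (∂D ∖ {0}) ∪ {0}`, and a `C¹` map sends null sets to null sets.
[folklore] -/
theorem adm_image_inversion {D : Set (EuclideanSpace ℝ (Fin 3))}
    (hD : IsOpen D ∧ volume (frontier D) = 0) (h0 : (0 : EuclideanSpace ℝ (Fin 3)) ∉ D) :
    IsOpen (inversion (0 : EuclideanSpace ℝ (Fin 3)) 1 '' D) ∧
      volume (frontier (inversion (0 : EuclideanSpace ℝ (Fin 3)) 1 '' D)) = 0 := by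
  refine ⟨isOpen_image_inversion hD.1 h0, ?_⟩
  refine measure_mono_null (frontier_image_inversion_subset hD.1 h0)
    (measure_union_null ?_ (measure_singleton 0))
  exact addHaar_image_eq_zero_of_differentiableOn_of_addHaar_eq_zero volume
    (differentiableOn_inversion_compl_zero.mono fun _ ha => ha.2)
    (measure_mono_null (fun _ ha => ha.1) hD.2)

/-! ### Two-point configurations -/

/-- A pair of distinct points is an injective two-point configuration. [folklore] -/
theorem injective_vec2 {x y : EuclideanSpace ℝ (Fin 3)} (h : x ≠ y) :
    Injective (![x, y] : Fin 2 → EuclideanSpace ℝ (Fin 3)) := by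
  intro i j hij
  fin_cases i <;> fin_cases j
  · rfl
  · exact absurd (by simpa using hij) h
  · exact absurd (by simpa using hij.symm) h
  · rfl

/-- A pair of distinct points of `D` is a non-coincident configuration in `D`. [folklore] -/
theorem vec2_mem {D : Set (EuclideanSpace ℝ (Fin 3))} {x y : EuclideanSpace ℝ (Fin 3)}
    (hx : x ∈ D) (hy : y ∈ D) (hxy : x ≠ y) :
    (![x, y] : Fin 2 → EuclideanSpace ℝ (Fin 3)) ∈
      NonCoincident 3 2 ∩ {x : Fin 2 → EuclideanSpace ℝ (Fin 3) | ∀ i, x i ∈ D} := by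
  refine ⟨(mem_nonCoincident _).2 (injective_vec2 hxy), ?_⟩
  rw [mem_setOf_eq, Fin.forall_fin_two]
  exact ⟨hx, hy⟩

/-! ### Limits of ratios -/

/-- If `ρ² gᵢ → aᵢ` (`i = 1, …, 4`) along a non-trivial filter with `a₂, a₄ ≠ 0` and `ρ ≠ 0`, and
`g₃/g₄ − g₁/g₂ → 0`, then `a₃/a₄ = a₁/a₂` (the renormalisation cancels in the ratios;
uniqueness of limits). [folklore] -/
theorem div_eq_div_of_tendsto {l : Filter ℝ} [l.NeBot] {ρ g₁ g₂ g₃ g₄ : ℝ → ℝ}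
    {a₁ a₂ a₃ a₄ : ℝ}
    (h₁ : Tendsto (fun δ => ρ δ ^ 2 * g₁ δ) l (𝓝 a₁))
    (h₂ : Tendsto (fun δ => ρ δ ^ 2 * g₂ δ) l (𝓝 a₂))
    (h₃ : Tendsto (fun δ => ρ δ ^ 2 * g₃ δ) l (𝓝 a₃))
    (h₄ : Tendsto (fun δ => ρ δ ^ 2 * g₄ δ) l (𝓝 a₄))
    (hρ : ∀ δ, ρ δ ≠ 0) (ha₂ : a₂ ≠ 0) (ha₄ : a₄ ≠ 0)
    (h : Tendsto (fun δ => g₃ δ / g₄ δ - g₁ δ / g₂ δ) l (𝓝 0)) :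
    a₃ / a₄ = a₁ / a₂ := by
  have key : Tendsto (fun δ => g₃ δ / g₄ δ - g₁ δ / g₂ δ) l (𝓝 (a₃ / a₄ - a₁ / a₂)) := by
    refine ((h₃.div h₄ ha₄).sub (h₁.div h₂ ha₂)).congr fun δ => ?_
    show ρ δ ^ 2 * g₃ δ / (ρ δ ^ 2 * g₄ δ) - ρ δ ^ 2 * g₁ δ / (ρ δ ^ 2 * g₂ δ) = _
    rw [mul_div_mul_left _ _ (pow_ne_zero 2 (hρ δ)), mul_div_mul_left _ _ (pow_ne_zero 2 (hρ δ))]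
  exact sub_eq_zero.1 (tendsto_nhds_unique key h)

/-! ### The full-space two-point kernel of a Euclidean, scale-covariant theory -/

/-- **Radial power law.** A translation invariant, `O(3)` invariant and scale covariant
(dimension `Δ`) two-point kernel on `ℝ³` is `H(x,y) = ‖y − x‖^{−2Δ} H(0,e₁)` (translate `x` to
`0`, reflect `e₁` onto `(y−x)/‖y−x‖`, dilate by `‖y−x‖`).
[cite: FrancescoMathieuSenechal1997, §4.3.1 eq. (4.55)] -/
theorem twoPoint_radial {Δ : ℝ} {H₀ : EuclideanSpace ℝ (Fin 3) → EuclideanSpace ℝ (Fin 3) → ℝ}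
    (htrans : ∀ v x y : EuclideanSpace ℝ (Fin 3), x ≠ y → H₀ (x + v) (y + v) = H₀ x y)
    (hrot : ∀ (R : EuclideanSpace ℝ (Fin 3) ≃ₗᵢ[ℝ] EuclideanSpace ℝ (Fin 3))
      (x y : EuclideanSpace ℝ (Fin 3)), x ≠ y → H₀ (R x) (R y) = H₀ x y)
    (hscale : ∀ c : ℝ, 0 < c → ∀ x y : EuclideanSpace ℝ (Fin 3), x ≠ y →
      H₀ (c • x) (c • y) = c ^ (-(2 : ℝ) * Δ) * H₀ x y)
    {x y : EuclideanSpace ℝ (Fin 3)} (hxy : x ≠ y) :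
    H₀ x y = ‖y - x‖ ^ (-(2 : ℝ) * Δ) * H₀ 0 (EuclideanSpace.single 0 1) := by
  set e : EuclideanSpace ℝ (Fin 3) := EuclideanSpace.single 0 1 with he
  have he1 : ‖e‖ = 1 := by simp [he]
  have he0 : e ≠ 0 := fun h => by simp [h] at he1
  -- translate `x` to the origin
  have h1 : H₀ x y = H₀ 0 (y - x) := by
    have h := htrans (-x) x y hxy
    rw [add_neg_cancel, ← sub_eq_add_neg] at h
    exact h.symm
  set u : EuclideanSpace ℝ (Fin 3) := y - x with hu
  have hu0 : u ≠ 0 := sub_ne_zero.2 hxy.symm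
  set t : ℝ := ‖u‖ with ht
  have htpos : 0 < t := norm_pos_iff.2 hu0
  -- reflect `e` onto `u / ‖u‖`
  set w : EuclideanSpace ℝ (Fin 3) := t⁻¹ • u with hw
  have hwn : ‖w‖ = 1 := by
    rw [hw, norm_smul, norm_inv, Real.norm_of_nonneg htpos.le, inv_mul_cancel₀ htpos.ne']
  set R := (Submodule.span ℝ {e - w})ᗮ.reflection with hR
  have hRe : R e = w := Submodule.reflection_sub (by rw [he1, hwn])
  have hte : (0 : EuclideanSpace ℝ (Fin 3)) ≠ t • e := (smul_ne_zero htpos.ne' he0).symm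
  have h2 : H₀ 0 (t • e) = H₀ 0 u := by
    have h := hrot R 0 (t • e) hte
    rw [map_zero, map_smul, hRe, hw, smul_smul, mul_inv_cancel₀ htpos.ne', one_smul] at h
    exact h.symm
  -- dilate by `‖u‖`
  have h3 : H₀ 0 (t • e) = t ^ (-(2 : ℝ) * Δ) * H₀ 0 e := by
    have h := hscale t htpos 0 e he0.symm
    rwa [smul_zero] at h
  rw [h1, ← h2, h3]

/-- **Inversion covariance of the full-space two-point kernel is automatic**: for a translation
invariant, `O(3)` invariant, scale covariant (dimension `Δ`) kernel,
`H(ιx, ιy) = ‖x‖^{2Δ} ‖y‖^{2Δ} H(x,y)` for `x ≠ y` off the origin, because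
`‖ιx − ιy‖ = ‖x − y‖ / (‖x‖‖y‖)`. [cite: FrancescoMathieuSenechal1997, §4.3.1 eq. (4.55)] -/
theorem twoPoint_inversion {Δ : ℝ} {H₀ : EuclideanSpace ℝ (Fin 3) → EuclideanSpace ℝ (Fin 3) → ℝ}
    (htrans : ∀ v x y : EuclideanSpace ℝ (Fin 3), x ≠ y → H₀ (x + v) (y + v) = H₀ x y)
    (hrot : ∀ (R : EuclideanSpace ℝ (Fin 3) ≃ₗᵢ[ℝ] EuclideanSpace ℝ (Fin 3))
      (x y : EuclideanSpace ℝ (Fin 3)), x ≠ y → H₀ (R x) (R y) = H₀ x y)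
    (hscale : ∀ c : ℝ, 0 < c → ∀ x y : EuclideanSpace ℝ (Fin 3), x ≠ y →
      H₀ (c • x) (c • y) = c ^ (-(2 : ℝ) * Δ) * H₀ x y)
    {x y : EuclideanSpace ℝ (Fin 3)} (hx : x ≠ 0) (hy : y ≠ 0) (hxy : x ≠ y) :
    H₀ (inversion 0 1 x) (inversion 0 1 y) = ‖x‖ ^ (2 * Δ) * ‖y‖ ^ (2 * Δ) * H₀ x y := by
  have hι : inversion (0 : EuclideanSpace ℝ (Fin 3)) 1 x ≠ inversion 0 1 y :=
    fun h => hxy (inversion_injective _ one_ne_zero h)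
  rw [twoPoint_radial htrans hrot hscale hι, twoPoint_radial htrans hrot hscale hxy]
  have hdist : ‖inversion (0 : EuclideanSpace ℝ (Fin 3)) 1 y - inversion 0 1 x‖ =
      ‖y - x‖ / (‖y‖ * ‖x‖) := by
    rw [← dist_eq_norm, dist_inversion_inversion hy hx, dist_eq_norm, dist_eq_norm,
      dist_eq_norm, sub_zero, sub_zero, one_pow, div_mul_eq_mul_div, one_mul]
  have h0 : 0 < ‖x‖ := norm_pos_iff.2 hx
  have h1 : 0 < ‖y‖ := norm_pos_iff.2 hy
  have hd : 0 < ‖y - x‖ := norm_pos_iff.2 (sub_ne_zero.2 hxy.symm)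
  rw [hdist, Real.div_rpow hd.le (by positivity), Real.mul_rpow h1.le h0.le]
  have e1 : ‖y‖ ^ (-(2 : ℝ) * Δ) = (‖y‖ ^ (2 * Δ))⁻¹ := by
    rw [show (-(2 : ℝ) * Δ) = -(2 * Δ) by ring, Real.rpow_neg h1.le]
  have e0 : ‖x‖ ^ (-(2 : ℝ) * Δ) = (‖x‖ ^ (2 * Δ))⁻¹ := by
    rw [show (-(2 : ℝ) * Δ) = -(2 * Δ) by ring, Real.rpow_neg h0.le]
  rw [e1, e0]
  have hp0 : 0 < ‖x‖ ^ (2 * Δ) := Real.rpow_pos_of_pos h0 _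
  have hp1 : 0 < ‖y‖ ^ (2 * Δ) := Real.rpow_pos_of_pos h1 _
  field_simp

end MoebiusRestrictionCurrentsAssembly

open MoebiusRestrictionCurrentsTargetSuffices MoebiusRestrictionCurrentsAssembly in
/-- **Glue `CruxesGiveTarget`** (support item `stmt-CriticalPhenomena-4859` of the route):
`TwoPointDomainTheory → RemovalRatioInversion → BackboneLift → Target`. From the two-point domain
theory take `Δ` and `H`; `RemovalRatioInversion` and the pointwise two-point limits give
`H_{ιD}(ιx,ιy)/H_{ℝ³}(ιx,ιy) = H_D(x,y)/H_{ℝ³}(x,y)` (the inverted domain `ι '' D` is again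
admissible, `adm_image_inversion`); Euclid + scale covariance give `H_{ℝ³}(x,y) = C‖x−y‖^{−2Δ}`,
hence `H_{ℝ³}(ιx,ιy) = ‖x‖^{2Δ}‖y‖^{2Δ}H_{ℝ³}(x,y)` and the inversion covariance of `H_D`;
`BackboneLift` then yields the domain family, and positivity of `S^{ℝ³}_2` is `S_2 = H > 0`.
(Duminil-Copin, ICM 2022, §8.2; Di Francesco–Mathieu–Sénéchal 1997, §4.3.1.) [folklore] -/
theorem moebiusRestrictionCurrents_cruxesGiveTarget_proof :
    Summit.CriticalPhenomena.Ising3DConformalLimit.Theses.MoebiusRestrictionCurrents.CruxesGiveTarget := by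
  classical
  unfold CruxesGiveTarget TwoPointDomainTheory RemovalRatioInversion BackboneLift Target
  intro hA hR hB
  dsimp only at hA hR hB ⊢
  obtain ⟨Δ, H, hΔ, hconv, hpos, htrans, hrot, hscale⟩ := hA
  -- Euclidean / scale covariance of the full-space kernel
  have htransU : ∀ v x y : EuclideanSpace ℝ (Fin 3), x ≠ y →
      H univ (x + v) (y + v) = H univ x y := by
    intro v x y hxy
    have h := htrans univ adm_univ v x y (mem_univ _) (mem_univ _) hxy
    rwa [image_univ_of_surjective (add_right_surjective v)] at h
  have hrotU : ∀ (R : EuclideanSpace ℝ (Fin 3) ≃ₗᵢ[ℝ] EuclideanSpace ℝ (Fin 3))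
      (x y : EuclideanSpace ℝ (Fin 3)), x ≠ y → H univ (R x) (R y) = H univ x y := by
    intro R x y hxy
    have h := hrot univ adm_univ R x y (mem_univ _) (mem_univ _) hxy
    rwa [image_univ_of_surjective R.surjective] at h
  have hscaleU : ∀ c : ℝ, 0 < c → ∀ x y : EuclideanSpace ℝ (Fin 3), x ≠ y →
      H univ (c • x) (c • y) = c ^ (-(2 : ℝ) * Δ) * H univ x y := by
    intro c hc x y hxy
    have h := hscale univ adm_univ c hc x y (mem_univ _) (mem_univ _) hxy
    rwa [image_univ_of_surjective] at h
    exact fun y => ⟨c⁻¹ • y, by simp [smul_smul, mul_inv_cancel₀ hc.ne']⟩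
  -- inversion covariance of the domain kernel
  have hinvH : ∀ D : Set (EuclideanSpace ℝ (Fin 3)), (IsOpen D ∧ volume (frontier D) = 0) →
      (0 : EuclideanSpace ℝ (Fin 3)) ∉ D → ∀ x y : EuclideanSpace ℝ (Fin 3), x ∈ D → y ∈ D →
      x ≠ y → H (inversion (0 : EuclideanSpace ℝ (Fin 3)) 1 '' D)
        (inversion (0 : EuclideanSpace ℝ (Fin 3)) 1 x)
        (inversion (0 : EuclideanSpace ℝ (Fin 3)) 1 y) =
        ‖x‖ ^ (2 * Δ) * ‖y‖ ^ (2 * Δ) * H D x y := by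
    intro D hadm h0 x y hx hy hxy
    have hadm' := adm_image_inversion hadm h0
    have hx0 : x ≠ 0 := fun h => h0 (h ▸ hx)
    have hy0 : y ≠ 0 := fun h => h0 (h ▸ hy)
    have hιxy : inversion (0 : EuclideanSpace ℝ (Fin 3)) 1 x ≠ inversion 0 1 y :=
      fun h => hxy (inversion_injective _ one_ne_zero h)
    have T1 := (hconv D hadm).tendsto_at (vec2_mem hx hy hxy)
    have T2 := (hconv univ adm_univ).tendsto_at (vec2_mem (mem_univ x) (mem_univ y) hxy)
    have T3 := (hconv _ hadm').tendsto_at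
      (vec2_mem (mem_image_of_mem _ hx) (mem_image_of_mem _ hy) hιxy)
    have T4 := (hconv univ adm_univ).tendsto_at (vec2_mem (mem_univ _) (mem_univ _) hιxy)
    simp only [Matrix.cons_val_zero, Matrix.cons_val_one] at T1 T2 T3 T4
    have hHu : H univ x y ≠ 0 := (hpos x y hxy).ne'
    have hHuι : H univ (inversion 0 1 x) (inversion 0 1 y) ≠ 0 := (hpos _ _ hιxy).ne'
    have hratio := div_eq_div_of_tendsto T1 T2 T3 T4 (fun δ => (rho_pos δ).ne') hHu hHuι
      (hR D hadm h0 x y hx hy hxy)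
    have hfull := twoPoint_inversion htransU hrotU hscaleU hx0 hy0 hxy
    have ha : H (inversion (0 : EuclideanSpace ℝ (Fin 3)) 1 '' D) (inversion 0 1 x)
        (inversion 0 1 y) = H D x y / H univ x y * H univ (inversion 0 1 x) (inversion 0 1 y) := by
      rw [← hratio, div_mul_cancel₀ _ hHuι]
    rw [ha, hfull]
    field_simp
  -- the backbone lift, and the target
  obtain ⟨S, hSconv, hS2, hStrans, hSrot, hSscale, hSinv⟩ :=
    hB Δ H hΔ hconv hpos ⟨htrans, hrot, hscale⟩ hinvH
  refine ⟨Δ, S, hΔ, hSconv, ?_, hStrans, hSrot, hSscale, hSinv⟩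
  intro x hx
  have hinj : Injective x := (mem_nonCoincident x).1 hx
  have hne : x 0 ≠ x 1 := hinj.ne (by decide)
  have hx2 : x = ![x 0, x 1] := by
    funext i; fin_cases i <;> rfl
  rw [hx2, hS2 univ adm_univ (x 0) (x 1) (mem_univ _) (mem_univ _) hne]
  exact hpos _ _ hne

/-- **Assembly of route `MoebiusRestrictionCurrents`** (item `stmt-CriticalPhenomena-4861`):
`TwoPointDomainTheory → RemovalRatioInversion → BackboneLift → IsingEuclidUpgradeR4NonGaussian →
FreeIsCritical → Ising3DConformalLimit`, the composition of the glue
`moebiusRestrictionCurrents_cruxesGiveTarget_proof` (cruxes ⇒ domain Möbius theory) with the tree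
theorem `moebiusRestrictionCurrents_targetSuffices_proof` (domain Möbius theory + shared
non-Gaussianity crux + free = critical ⇒ the conjunct). (Aizenman 1982; Duminil-Copin, ICM 2022,
§8.2.) [folklore] -/
theorem moebiusRestrictionCurrents_assembly_proof :
    Summit.CriticalPhenomena.Ising3DConformalLimit.Theses.MoebiusRestrictionCurrents.Assembly := by
  unfold Assembly
  intro hA hR hB hNG hFree
  exact moebiusRestrictionCurrents_targetSuffices_proof
    (moebiusRestrictionCurrents_cruxesGiveTarget_proof hA hR hB) hNG hFree

end Summit.CriticalPhenomena.Ising3DConformalLimit.Theorems
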